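import Summits.HodgeConjecture.HodgeConjecture.Theorems.F0P6aStubDOWNLaws
import HarnessLib

/-!
# `F0P6aStubDOWNProvider` — ★ RE-HOME of `Lines/F0_P6a_StubDOWN.lean`, PART 2 of 7 (size-lint split; cut at a declaration boundary).

Imports: ★ `Theorems.F0P6aStubDOWNLaws` = the previous part of the same Lines workfile `F0_P6a_StubDOWN` (size-lint split ×7) + `HarnessLib` (canonical header: bare `import` lines).
See PART 1 `Theorems/F0P6aStubDOWNLaws.lean` for the full re-home header and the original module docstring (verbatim there). Namespaces and sections KEPT
(re-opened below exactly as they stand at the cut, with their `open`∕`variable` lines replayed); code bytes = the workfile՚s, docstrings included; options preamble repeated from PART 1.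
HC_CM is proved only modulo the 7 printed citations (2 remaining: hLiu418 = stmt-HodgeConjecture-24832, h413 = stmt-HodgeConjecture-24833) until rung 0 closes; a re-home is count-neutral. -/

set_option autoImplicit false
set_option linter.dupNamespace false

noncomputable section

namespace Summit.HodgeConjecture.HodgeConjecture.Cruxes.HLiu418.F0P6aStubDOWN
open CategoryTheory CategoryTheory.Limits NumberField IsDedekindDomain MulAction
open scoped Matrix Polynomial Pointwise MonoidalCategory
open Literature.NumberTheory.GaloisRepresentations
open Literature.NumberTheory.Automorphic Literature.NumberTheory.Automorphic.UnitaryGroup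
open Literature.AlgebraicGeometry.ShimuraVarieties.UnitaryCanonicalModel
open Literature.NumberTheory.Automorphic.Liu2021.AppendixC
open Literature.AlgebraicGeometry.Motives (AlgPoints IntegralModel SchemeOver thickening thickeningGalAction thickeningLift specOver relFrobeniusOver frobeniusTwistOver)
open Literature.NumberTheory.DiophantineGeometry (geomResidueField specialFibreFunctor specResidueField)
open Literature.AlgebraicGeometry.RelativeSpec (ActionOver)
open Literature.NumberTheory.EllipticCurves (genericFibre)
open Literature.AlgebraicGeometry.GroupSchemes.AffineGroupScheme (Alg quotIncl)
open Summit.HodgeConjecture.HodgeConjecture.Cruxes.HLiu418.F0P6cDictConstructors (kerFI AdmSub IdealIsEtale isAdm_kerFI)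
open Summit.HodgeConjecture.HodgeConjecture.Cruxes.HLiu418.F0P6aModuliDatumDefs
open Summit.HodgeConjecture.HodgeConjecture.Cruxes.HLiu418.F0P6aRGDAssembly
open Summit.HodgeConjecture.HodgeConjecture.Cruxes.HLiu418.F0P6aDatumOfInputs
open Summit.HodgeConjecture.HodgeConjecture.Cruxes.HLiu418.F0P6aLineSpecialisation (spGeoOf canonicalLine_spGeoOf spGeoOf_surjective hrkG_of_dock
  exists_isogW₀_of_quotLeg mono_coverPin₀ le_ker_isogW₀_of_himg red₀Of_translΩ_eq_of_red₀Of_eq red₀Of_quotΩ_eq_red₀Of_translΩ_of_le_ker_layer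
  red₀Of_quotΩ_eq_of_quotLegReduction₀)  -- [ED. 4] organ heads BY NAME (incl. the §Q head `red₀Of_quotΩ_eq_of_quotLegReduction₀`, PART B)

section Fold
open AlgebraicGeometry Literature.AlgebraicGeometry.AbelianSchemes Literature.AlgebraicGeometry.AbelianSchemes.AbelianSchemeOver
variable {F : Type} [Field F] [NumberField F] [IsCMField F] {ι₁ : F →+* ℂ}
    {Jstar : Matrix (Fin 2) (Fin 2) F}
    {K₀ : C5.OpenCompactSubgroup ↥(finAdelic ↥(maximalRealSubfield F) F (IsCMField.complexConj F) 2 Jstar)}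
    {S : RecordSystemGS F Jstar ι₁ K₀} {hU7ₛ : S.HeckeTranslateDefinedOver}
    {hJ : (Jstar.map (IsCMField.complexConj F))ᵀ = Jstar} {hJu : IsUnit Jstar}
    {Fi : Type} [Field Fi] [Algebra F Fi] {Kc : C5.SmallLevel K₀} {G : Type} [Group G]
    {𝓜 : IntegralModel (𝓞 F) F ((thickening F Fi).obj (S.M.obj Kc))}
    {w : HeightOneSpectrum (𝓞 F)} {hw : (IsCMField.complexConj F) • w ≠ w} {h𝓨 : (𝓜.localise w).IsSmoothProper 1}
    {θ : ActionOver (𝓜.localise w).total.hom ((Fi ≃ₐ[F] Fi) × G)}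
    {e : Fi →ₐ[F] AlgebraicClosure (w.adicCompletion F)}


set_option maxHeartbeats 400000 in
/-- **THE `e`-SHEET LAYER ISO FROM A FIBRE-LEVEL RECOGNITION** (= LA2-p04՚s `hsheet` binder at `(τ, y)`), OVER AN ABSTRACT FIBRE FAMILY `(Afib, actfib)`: ★ (R9′)
`exists_layerIso_of_fibreRecognition_of_rank` at the docks `𝔡 (red₀ y)` and `𝔡 (θ(τ,1)_s (red₀ y))`, the second point rewritten as `red₀^{e∘τ⁻¹} y` by
★ `geomReductionMap_thickeningLift_comp_symm` INSIDE the equation binder of `hrec` (no rewriting of dock points).  USE at the leaf (`𝔡 : ∀ x̄, DockAt I x̄`):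
`layerIso_on_sheet_of_fibreRecognition I 𝔡 (fun x̄ => <any proof of commutativity of the fibre>) _hθ ‹recognition› τ y` — `Afib`, `actfib` are inferred from `𝔡`.
[cite: Liu2021, Prop. D.8 p. 135, p. 137] [cite: RapoportSmithlingZhang2020Diagonal, Lemma 3.4–Prop. 3.7, pp. 12–14] [cite: Tate1997FiniteFlatGroupSchemes, (3.7)]
[cite: Conrad2004GrossZagier, §7 (Thm. 7.5)] -/
theorem layerIso_on_sheet_of_fibreRecognition (I : RGDInputsAt F ι₁ Jstar K₀ S hU7ₛ hJ hJu Fi Kc G 𝓜 w hw h𝓨 θ e) [ExpChar (geomResidueField w) I.pChar]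
    {Afib : AlgPoints (𝓜.localise w).reductionAt (geomResidueField w) → AbelianSchemeOver (Spec (@CommRingCat.of (geomResidueField w) Field.toCommRing))}
    {actfib : ∀ xbar, (Afib xbar).RingAction (𝓞 F)}
    (𝔡 : ∀ xbar, DockData (geomResidueField w) I.pChar I.fDeg (Afib xbar) (actfib xbar) ((IsCMField.complexConj F • w).asIdeal))
    (hcomm : ∀ xbar, IsCommMonObj (Afib xbar).X)
    (hθ : ∀ γ : Fi ≃ₐ[F] Fi,
       (genericFibre (HeightOneSpectrum.valuationSubringAtPrime F w) F).map
             (Over.isoMk (θ.aut (γ, 1)) (θ.aut_comp (γ, 1))).hom ≫ (𝓜.localise w).genericIso'.hom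
         = (𝓜.localise w).genericIso'.hom ≫
             (Over.isoMk ((thickeningGalAction (L := Fi) (S.M.obj Kc)).aut γ)
               ((thickeningGalAction (L := Fi) (S.M.obj Kc)).aut_comp γ)).hom)
    (hrec : ∀ (τ : Fi ≃ₐ[F] Fi) (y : AlgPoints (S.M.obj Kc) (AlgebraicClosure (w.adicCompletion F)))
        (p₁ p₂ : AlgPoints (𝓜.localise w).reductionAt (geomResidueField w)),
        red₀Of S Kc 𝓜 w h𝓨 e y = p₁ → red₀Of S Kc 𝓜 w h𝓨 (e.comp (τ.symm : Fi →ₐ[F] Fi)) y = p₂ →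
      ∃ (m : ℕ) (E : Matrix (Fin m) (Fin m) (𝓞 F)) (hE : E * E = E) (P : Matrix (Fin m) (Fin 1) (𝓞 F)) (Q : Matrix (Fin 1) (Fin m) (𝓞 F)) (N : ℕ),
        N ≠ 0 ∧ E * P = P ∧ Q * E = Q ∧ Q * P = Matrix.scalar (Fin 1) (N : 𝓞 F) ∧ P * Q = Matrix.scalar (Fin m) (N : 𝓞 F) * E ∧
        (∀ j k', Q j k' ∈ Set.range fun k' => Q 0 k') ∧
        (∀ c ∈ Set.range (fun k' => Q 0 k'), ∃ Pc : Matrix (Fin m) (Fin 1) (𝓞 F), E * Pc = Pc ∧ Pc * Q = c • E) ∧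
        ∃ (u : (@serreTensor _ (Afib p₁) (𝓞 F) _ (actfib p₁) (hcomm p₁) m E hE).X ⟶ (Afib p₂).X)
          (_ : IsMonHom u) (_ : IsIso u),
          ∀ a : 𝓞 F, (@serreAction _ (Afib p₁) (𝓞 F) _ (actfib p₁) (hcomm p₁) m E hE).i a ≫ u = u ≫ (actfib p₂).i a)
    (τ : Fi ≃ₐ[F] Fi) (y : AlgPoints (S.M.obj Kc) (AlgebraicClosure (w.adicCompletion F))) :
    letI := (𝔡 (red₀Of S Kc 𝓜 w h𝓨 e y)).grp₀; letI := (𝔡 (actOf S Kc 𝓜 w θ τ (red₀Of S Kc 𝓜 w h𝓨 e y))).grp₀;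
    ∃ φ : (𝔡 (red₀Of S Kc 𝓜 w h𝓨 e y)).G₀ ≅ (𝔡 (actOf S Kc 𝓜 w θ τ (red₀Of S Kc 𝓜 w h𝓨 e y))).G₀,
      IsMonHom φ.hom ∧ ∀ a : 𝓞 F, (𝔡 (red₀Of S Kc 𝓜 w h𝓨 e y)).β₀ a ≫ φ.hom = φ.hom ≫ (𝔡 (actOf S Kc 𝓜 w θ τ (red₀Of S Kc 𝓜 w h𝓨 e y))).β₀ a := by
  -- TOWER FINDINGS (F1)–(F5): no `obtain`, no rewriting of dock points, `letI` group structures, ranks before instances, fibres as variables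
  letI hprop : AlgebraicGeometry.IsProper (𝓜.localise w).total.hom := h𝓨.2
  -- the second dock point IS the reduction of the `e ∘ τ⁻¹`-sheet reading of `y`
  have h₂ : red₀Of S Kc 𝓜 w h𝓨 (e.comp (τ.symm : Fi →ₐ[F] Fi)) y = actOf S Kc 𝓜 w θ τ (red₀Of S Kc 𝓜 w h𝓨 e y) :=
    Literature.AlgebraicGeometry.Motives.IntegralModel.geomReductionMap_thickeningLift_comp_symm (S.M.obj Kc) (𝓜.localise w) θ hθ e τ y
  -- `0 < q²`
  have hq : 0 < I.pChar ^ I.fDeg * I.pChar ^ I.fDeg :=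
    Nat.mul_pos (pow_pos I.hpChar.1.pos _) (pow_pos I.hpChar.1.pos _)
  -- the two docks: group structures (zeta-reducible `letI`), affine, finite; commutativity of the fibres is the local instance `hcomm`
  letI := (𝔡 (red₀Of S Kc 𝓜 w h𝓨 e y)).grp₀
  letI := (𝔡 (actOf S Kc 𝓜 w θ τ (red₀Of S Kc 𝓜 w h𝓨 e y))).grp₀
  haveI := (𝔡 (red₀Of S Kc 𝓜 w h𝓨 e y)).aff₀
  haveI := (𝔡 (actOf S Kc 𝓜 w θ τ (red₀Of S Kc 𝓜 w h𝓨 e y))).aff₀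
  haveI := (𝔡 (red₀Of S Kc 𝓜 w h𝓨 e y)).fin₀
  haveI := (𝔡 (actOf S Kc 𝓜 w θ τ (red₀Of S Kc 𝓜 w h𝓨 e y))).fin₀
  -- ★ (R9′): presentation + fibre-level recognition as ONE package, ranks from the dock rows `hrkG₀`
  exact (exists_layerIso_of_fibreRecognition_of_rank
      (G₁ := (𝔡 (red₀Of S Kc 𝓜 w h𝓨 e y)).G₀) (G₂ := (𝔡 (actOf S Kc 𝓜 w θ τ (red₀Of S Kc 𝓜 w h𝓨 e y))).G₀)
      (actfib (red₀Of S Kc 𝓜 w h𝓨 e y)) (actfib (actOf S Kc 𝓜 w θ τ (red₀Of S Kc 𝓜 w h𝓨 e y)))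
      ((IsCMField.complexConj F • w).asIdeal)
      (hrec τ y (red₀Of S Kc 𝓜 w h𝓨 e y) (actOf S Kc 𝓜 w θ τ (red₀Of S Kc 𝓜 w h𝓨 e y)) rfl h₂)
      (𝔡 (red₀Of S Kc 𝓜 w h𝓨 e y)).hrkG₀ (𝔡 (actOf S Kc 𝓜 w θ τ (red₀Of S Kc 𝓜 w h𝓨 e y))).hrkG₀ hq
      (𝔡 (red₀Of S Kc 𝓜 w h𝓨 e y)).ι₀G (𝔡 (red₀Of S Kc 𝓜 w h𝓨 e y)).hι₀G (𝔡 (red₀Of S Kc 𝓜 w h𝓨 e y)).hkerG₀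
      (𝔡 (red₀Of S Kc 𝓜 w h𝓨 e y)).β₀ (𝔡 (red₀Of S Kc 𝓜 w h𝓨 e y)).hβ₀G
      (𝔡 (actOf S Kc 𝓜 w θ τ (red₀Of S Kc 𝓜 w h𝓨 e y))).ι₀G (𝔡 (actOf S Kc 𝓜 w θ τ (red₀Of S Kc 𝓜 w h𝓨 e y))).hι₀G
      (𝔡 (actOf S Kc 𝓜 w θ τ (red₀Of S Kc 𝓜 w h𝓨 e y))).hkerG₀
      (𝔡 (actOf S Kc 𝓜 w θ τ (red₀Of S Kc 𝓜 w h𝓨 e y))).β₀ (𝔡 (actOf S Kc 𝓜 w θ τ (red₀Of S Kc 𝓜 w h𝓨 e y))).hβ₀G).imp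
    fun φ hφ => ⟨hφ.1, hφ.2.2.1⟩

end Fold

/-! ### §D (HREC) THE PROVIDER (LA2-p03 (g2)) -/

section Provider
open AlgebraicGeometry Literature.AlgebraicGeometry.AbelianSchemes Literature.AlgebraicGeometry.AbelianSchemes.AbelianSchemeOver

open scoped MonObj Obj

variable {F : Type} [Field F] [NumberField F] [IsCMField F] {ι₁ : F →+* ℂ}
    {Jstar : Matrix (Fin 2) (Fin 2) F}
    {K₀ : C5.OpenCompactSubgroup ↥(finAdelic ↥(maximalRealSubfield F) F (IsCMField.complexConj F) 2 Jstar)}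
    {S : RecordSystemGS F Jstar ι₁ K₀} {hU7ₛ : S.HeckeTranslateDefinedOver}
    {hJ : (Jstar.map (IsCMField.complexConj F))ᵀ = Jstar} {hJu : IsUnit Jstar}
    {Fi : Type} [Field Fi] [Algebra F Fi] {Kc : C5.SmallLevel K₀} {G : Type} [Group G]
    {𝓜 : IntegralModel (𝓞 F) F ((thickening F Fi).obj (S.M.obj Kc))}
    {w : HeightOneSpectrum (𝓞 F)} {hw : (IsCMField.complexConj F) • w ≠ w} {h𝓨 : (𝓜.localise w).IsSmoothProper 1}
    {θ : ActionOver (𝓜.localise w).total.hom ((Fi ≃ₐ[F] Fi) × G)}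
    {e : Fi →ₐ[F] AlgebraicClosure (w.adicCompletion F)}

set_option maxHeartbeats 400000 in
/-- **(HREC) THE PROVIDER — THE FIBRE-LEVEL RECOGNITION PACKAGE ON THE `e`-SHEET FROM THE SPINE'S K-LAW COVER** (= the `hrec` binder of
`layerIso_on_sheet_of_fibreRecognition`, over an abstract fibre family `(Afib, actfib)` EQUAL to the universal fibres): for `τ`, `y` and special points `p₁ = red₀^{e} y`,
`p₂ = red₀^{e∘τ⁻¹} y`, destructure row 40 `I.coverKerΩ e τ⁻¹ y` (the generic Serre cover `c : A_{e,y} → A_{e∘τ⁻¹,y}` with (t1) the two-sided presentation of `𝔞_{τ⁻¹}`, (t1′) the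
all-`T` kernel law, (t4) equivariance), feed ★ `exists_fibreRecognitionPkg_of_cover` (★ presentation of `𝔞_{τ⁻¹} ≠ 0` = `I.twistIdeal_ne_bot`, ★ (ν8k) reduction, ★ KER-EQ recognition over
`κ̄(w)`) at the model `𝓜.localise w` (proper by `h𝓨.2`, `univ` commutative by `I.comm`), and move the package to `(Afib, actfib)` along the fibre equations `hA`, `hact` by ★
`fibreRecognitionPkg_transport` (decided on OBJECTS by `rfl` ∕ `HEq.rfl` at the call site, never inside group-structure instances — dock doctrine (D2)).
[cite: Shimura1998, §13.1 Thm. 1 (pp. 97–99); §18.6 (p. 127)] [cite: SerreTate1968, §1 Lemma 2, Thm 1] [cite: Conrad2004GrossZagier, §7 (Thm. 7.5)] [cite: MumfordAV1970, §7 Thm. 4 (p. 72)] -/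
theorem hrec_of_inputs (I : RGDInputsAt F ι₁ Jstar K₀ S hU7ₛ hJ hJu Fi Kc G 𝓜 w hw h𝓨 θ e)
    {Afib : AlgPoints (𝓜.localise w).reductionAt (geomResidueField w) → AbelianSchemeOver (Spec (@CommRingCat.of (geomResidueField w) Field.toCommRing))}
    {actfib : ∀ xbar, (Afib xbar).RingAction (𝓞 F)}
    (hA : ∀ xbar, (I.univ.baseChange (pullback.fst (𝓜.localise w).total.hom (specResidueField w))).baseChange xbar.left = Afib xbar)
    (hact : ∀ xbar, HEq ((I.act.baseChange (pullback.fst (𝓜.localise w).total.hom (specResidueField w))).baseChange xbar.left) (actfib xbar))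
    (hcomm : ∀ xbar, IsCommMonObj (Afib xbar).X)
    (τ : Fi ≃ₐ[F] Fi) (y : AlgPoints (S.M.obj Kc) (AlgebraicClosure (w.adicCompletion F)))
    (p₁ p₂ : AlgPoints (𝓜.localise w).reductionAt (geomResidueField w))
    (h₁ : red₀Of S Kc 𝓜 w h𝓨 e y = p₁) (h₂ : red₀Of S Kc 𝓜 w h𝓨 (e.comp (τ.symm : Fi →ₐ[F] Fi)) y = p₂) :
    ∃ (m : ℕ) (E : Matrix (Fin m) (Fin m) (𝓞 F)) (hE : E * E = E) (P : Matrix (Fin m) (Fin 1) (𝓞 F)) (Q : Matrix (Fin 1) (Fin m) (𝓞 F)) (N : ℕ),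
      N ≠ 0 ∧ E * P = P ∧ Q * E = Q ∧ Q * P = Matrix.scalar (Fin 1) (N : 𝓞 F) ∧ P * Q = Matrix.scalar (Fin m) (N : 𝓞 F) * E ∧
      (∀ j k', Q j k' ∈ Set.range fun k' => Q 0 k') ∧
      (∀ c ∈ Set.range (fun k' => Q 0 k'), ∃ Pc : Matrix (Fin m) (Fin 1) (𝓞 F), E * Pc = Pc ∧ Pc * Q = c • E) ∧
      ∃ (u : (@serreTensor _ (Afib p₁) (𝓞 F) _ (actfib p₁) (hcomm p₁) m E hE).X ⟶ (Afib p₂).X)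
        (_ : IsMonHom u) (_ : IsIso u),
        ∀ a : 𝓞 F, (@serreAction _ (Afib p₁) (𝓞 F) _ (actfib p₁) (hcomm p₁) m E hE).i a ≫ u = u ≫ (actfib p₂).i a := by
  -- row 40 of the spine: the generic Serre cover between the sheets `e`, `e ∘ τ⁻¹` at `y`, with (t1), (t1′), (t4)
  obtain ⟨c, hc, h1, hK, -, -, h4, -⟩ := I.coverKerΩ e τ.symm y
  -- ★ provider at the universal fibres (instances `IsProper := h𝓨.2`, `IsCommMonObj univ.X := I.comm`, `IsMonHom c := hc` passed BY POSITION: the spine՚s instance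
  -- terms are defeq, not syntactically equal, to the ★ binders՚ — default-transparency unification, no type-class synthesis), then ★ transport to `(Afib, actfib)`
  exact fibreRecognitionPkg_transport
    (@isCommMonObj_baseChange _ _ p₁.left _ (@isCommMonObj_baseChange _ _ _ I.univ I.comm)) (hcomm p₁)
    (hA p₁) (hact p₁) (hA p₂) (hact p₂)
    (@exists_fibreRecognitionPkg_of_cover _ _ _ _ _ (𝓜.localise w) h𝓨.2 _ _ _ _ I.act I.comm (thickeningLift e (S.M.obj Kc) y)
      (thickeningLift (e.comp (τ.symm : Fi →ₐ[F] Fi)) (S.M.obj Kc) y)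
      (fun xbar => @isCommMonObj_baseChange _ _ xbar.left _ (@isCommMonObj_baseChange _ _ _ I.univ I.comm))
      _ (I.twistIdeal_ne_bot τ.symm) c hc h1 hK h4 p₁ p₂ h₁ h₂)

end Provider

/-! ### §Σ THE SPEC ASSEMBLY — `stub_SPEC` over the organ heads (LA2-p04 (g2) (Σ) v2 22ed505c + binder order of record 09:29:54Z, VERBATIM; imports served `SpecOrgans` by name) -/

section Helpers

open AlgebraicGeometry
open Literature.AlgebraicGeometry.AbelianSchemes Literature.AlgebraicGeometry.AbelianSchemes.AbelianSchemeOver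
open Summit.HodgeConjecture.HodgeConjecture.Cruxes.HLiu418.F0P6aLineSpecialisation (spGeoOf canonicalLine_spGeoOf spGeoOf_surjective)

open scoped MonObj CategoryTheory.Obj

/-- The trivial morphism `1 : M ⟶ N` between monoid objects of a cartesian monoidal category is a homomorphism (`1 = toUnit ≫ η`).
[cite: MumfordAV1970, §11 p. 95] -/
theorem isMonHom_one {C : Type*} [Category C] [CartesianMonoidalCategory C] {M N : C} [MonObj M] [MonObj N] :
    IsMonHom (1 : M ⟶ N) := by
  rw [CategoryTheory.Hom.one_def]
  infer_instance

/-- Drop the last of nine conjuncts under a double existential whose second binder the conjuncts may depend on (row bookkeeping: the (ρ1𝒞) rows minus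
(IMG) are the [WQ] `hdat` rows; stated generically so that NO `cases` runs against a large goal).
RE-EXPORTED BY NAME (tree theorem; nothing new is asserted; gate `dedup.landed`): the statement is ★ `…F0P6aStubFROBQuotWD.exists₂_take₈` token for token («M-142h» (iii′)). -/
alias exists₂_dropLast := Summit.HodgeConjecture.HodgeConjecture.Cruxes.HLiu418.F0P6aStubFROBQuotWD.exists₂_take₈

end Helpers

section SpecAssembly

open AlgebraicGeometry
open Literature.AlgebraicGeometry.AbelianSchemes Literature.AlgebraicGeometry.AbelianSchemes.AbelianSchemeOver
open Summit.HodgeConjecture.HodgeConjecture.Cruxes.HLiu418.F0P6aLineSpecialisation (spGeoOf canonicalLine_spGeoOf spGeoOf_surjective)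

open scoped MonObj CategoryTheory.Obj

-- the frame of the D-line՚s `Letters` section VERBATIM
variable {F : Type} [Field F] [NumberField F] [IsCMField F] {ι₁ : F →+* ℂ}
    {Jstar : Matrix (Fin 2) (Fin 2) F}
    {K₀ : C5.OpenCompactSubgroup ↥(finAdelic ↥(maximalRealSubfield F) F (IsCMField.complexConj F) 2 Jstar)}
    {S : RecordSystemGS F Jstar ι₁ K₀} {hU7ₛ : S.HeckeTranslateDefinedOver}
    {hJ : (Jstar.map (IsCMField.complexConj F))ᵀ = Jstar} {hJu : IsUnit Jstar}
    {Fi : Type} [Field Fi] [Algebra F Fi] {Kc : C5.SmallLevel K₀} {G : Type} [Group G]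
    {𝓜 : IntegralModel (𝓞 F) F ((thickening F Fi).obj (S.M.obj Kc))}
    {w : HeightOneSpectrum (𝓞 F)} {hw : (IsCMField.complexConj F) • w ≠ w} {h𝓨 : (𝓜.localise w).IsSmoothProper 1}
    {θ : ActionOver (𝓜.localise w).total.hom ((Fi ≃ₐ[F] Fi) × G)}
    {e : Fi →ₐ[F] AlgebraicClosure (w.adicCompletion F)}

/-- **`exists_line_of_eq` — SP-SURJECTIVITY MOVED ALONG A POINT EQUATION**: for `red₀ y = x̄` and `H ∈ SubOf I 𝔡 x̄` there is a line `L` at `y` with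
`(red₀ y = x̄) ▸ spGeoOf I 𝔡 y L = H` (`subst` + `spGeoOf_surjective`; D-line lesson (F1): point equalities ride binders). [cite: Liu2021, p. 137]
[cite: Tate1997FiniteFlatGroupSchemes, (3.7)] -/
theorem exists_line_of_eq (I : RGDInputsAt F ι₁ Jstar K₀ S hU7ₛ hJ hJu Fi Kc G 𝓜 w hw h𝓨 θ e) [ExpChar (geomResidueField w) I.pChar]
    (𝔡 : ∀ xbar, DockAt I xbar) {xbar : AlgPoints (𝓜.localise w).reductionAt (geomResidueField w)}
    (y : AlgPoints (S.M.obj Kc) (AlgebraicClosure (w.adicCompletion F))) (hx : red₀Of S Kc 𝓜 w h𝓨 e y = xbar) (H : SubOf I 𝔡 xbar) :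
    ∃ L : LineOf I y, hx ▸ spGeoOf I 𝔡 y L = H := by
  subst hx
  obtain ⟨L, hL⟩ := spGeoOf_surjective I 𝔡 y H
  exact ⟨L, hL⟩

end SpecAssembly
end Summit.HodgeConjecture.HodgeConjecture.Cruxes.HLiu418.F0P6aStubDOWN
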